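import Summits.Ventures.PercRepro.C041ZoneLocal

/-!
# The per-zone reading of `K(S)` and of the red reach avoiding the deleted vertices — facts (F1) and (F4) of
C-041.md §11 on a single cube state (p6, gen 26)

Setting of `C041ZoneLocal`.  For a zone `Z` of `O` the ANCHORS are the vertices of `Z ∩ K₀`; `K_Z` is the set of
vertices of `Z` red-reachable inside `Z` from an anchor (`KZone`), and `REACH_Z` (side `a`) the set of vertices of `Z`
reachable from a non-deleted anchor by a red walk inside `Z` through non-deleted vertices (`ReachZone`).

* **(F1), per zone** `mem_bareReach_iff_kZone`: for a tail-free `O` and a cube state `S`, a vertex of the zone `Z`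
  lies in `K(S)` iff it lies in `K_Z` (an opened walk from an anchor stays in the anchor's zone:
  `redIn_walk_of_openedWalk`);
* **(F4)** `reachZone_of_bareWalkAvoiding`: a red bare walk from the probe avoiding `D_a` enters a zone `Z` through an
  anchor and continues inside `Z` through non-deleted vertices, so its end lies in `REACH_Z`;
* the first-arrival decomposition of a red walk avoiding `D_a` (`bareWalkAvoiding_or_redAttached_of_walkAvoiding`,
  Lemma A with an avoided set) and its consequence for `Good_a` (`exists_bareWalkAvoiding_of_goodA`): a red walk from
  the probe to `b` avoiding `D_a` ends with a red `b`-edge at a vertex reached by a red BARE walk avoiding `D_a`.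
-/

namespace PercRepro

namespace MultiGraph

open Finset

variable {V E : Type*} {G : MultiGraph V E}

section KZone

variable (G) (a b c : V)

/-- `K_Z`: the vertices red-reachable inside `Z` from an anchor (a vertex of `Z ∩ K₀`). -/
def KZone (O S : Config E) (Z : Finset V) (v : V) : Prop :=
  ∃ w ∈ Z, w ∈ G.BareReach a b c O ∧ Relation.ReflTransGen (G.RedIn a b S Z) w v

/-- `REACH_Z` on side `a`: the vertices reachable from a non-deleted anchor of `Z` by a red walk inside `Z` through
non-deleted vertices. -/
def ReachZone (O S : Config E) (Z : Finset V) (v : V) : Prop :=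
  ∃ w ∈ Z, w ∈ G.BareReach a b c O ∧ w ∉ G.cluster Sᶜ a ∧
    Relation.ReflTransGen (fun x y => G.RedIn a b S Z x y ∧ y ∉ G.cluster Sᶜ a) w v

variable {G a b c}

/-- A blue-bare-connected vertex of `O` lies in the same zone. -/
theorem mem_zone_of_blueBareConn_O [Fintype V] {O : Config E} {z v w : V} (hv : v ∈ G.zone a b O z)
    (h : G.BlueBareConn a b O v w) : w ∈ G.zone a b O z := by
  rw [mem_zone] at hv ⊢
  exact hv.trans h

/-- An opened walk from a vertex of the zone `Z` is a red walk inside `Z`. -/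
theorem redIn_walk_of_openedWalk [Fintype V] {O S : Config E} {z w v : V} (hw : w ∈ G.zone a b O z)
    (h : Relation.ReflTransGen (G.OpenedAdj a b O S) w v) :
    Relation.ReflTransGen (G.RedIn a b S (G.zone a b O z)) w v := by
  induction h with
  | refl => exact Relation.ReflTransGen.refl
  | @tail x y hwx hxy ih =>
    obtain ⟨e, he, hO, hSe, hj⟩ := hxy
    have hx : x ∈ G.zone a b O z := mem_zone_of_blueBareConn_O hw (blueBareConn_of_openedWalk hwx)
    have hy : y ∈ G.zone a b O z := mem_zone_of_blueBareConn_O hx (BlueBareConn.single ⟨e, he, hO, hj⟩)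
    exact ih.tail ⟨e, zoneEdge_of_joins he hj hx hy, he, hSe, hj⟩

/-- `K_Z ⊆ K(S)` for a cube state. -/
theorem mem_bareReach_of_kZone {O S : Config E} (hS : ∀ e, G.Bare a b e → O e = true → S e = true)
    {Z : Finset V} {v : V} (h : G.KZone a b c O S Z v) : v ∈ G.BareReach a b c S := by
  obtain ⟨w, _, hw, hwv⟩ := h
  exact Relation.ReflTransGen.trans (bareReach_O_subset a b c hS hw) (reflTransGen_bareAdj_of_redIn hwv)

/-- **(F1), per zone**: for a tail-free `O` and a cube state `S`, a vertex of the zone `Z = zone z` lies in `K(S)` iff it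
lies in `K_Z`. -/
theorem mem_bareReach_iff_kZone [Fintype V] {O S : Config E} (hO : G.TailFree a b c O)
    (hS : ∀ e, G.Bare a b e → O e = true → S e = true) {z v : V} (hv : v ∈ G.zone a b O z) :
    v ∈ G.BareReach a b c S ↔ G.KZone a b c O S (G.zone a b O z) v := by
  constructor
  · intro h
    rcases (mem_bareReach_iff_of_tailFree hO hS).1 h with hK | ⟨w, hw, hwv⟩
    · exact ⟨v, hv, hK, Relation.ReflTransGen.refl⟩
    · have hwz : w ∈ G.zone a b O z :=
        mem_zone_of_blueBareConn_O hv (blueBareConn_of_openedWalk hwv).symm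
      exact ⟨w, hwz, hw, redIn_walk_of_openedWalk hwz hwv⟩
  · exact mem_bareReach_of_kZone hS

end KZone

section Reach

variable (a b c : V)

/-- A bare edge with one end in the zone `Z = zone z` and the other outside it is red in `O` (blue bare `O`-edges stay
inside zones). -/
theorem O_red_of_leaves_zone [Fintype V] {O : Config E} {z x y : V}
    (hx : x ∉ G.zone a b O z) (hy : y ∈ G.zone a b O z) {e : E} (he : G.Bare a b e)
    (hj : G.Joins e x y) : O e = true := by
  by_contra h
  have hO : O e = false := by
    cases h' : O e
    · rfl
    · exact absurd h' h
  exact hx (mem_zone_of_blueBareConn_O hy (BlueBareConn.single ⟨e, he, hO, hj.symm⟩))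

/-- A red walk inside `Z` through non-deleted vertices is a red walk inside `Z`. -/
theorem redIn_walk_of_avoiding {S : Config E} {Z : Finset V} {W : Set V} {u v : V}
    (h : Relation.ReflTransGen (fun x y => G.RedIn a b S Z x y ∧ y ∉ W) u v) :
    Relation.ReflTransGen (G.RedIn a b S Z) u v := by
  induction h with
  | refl => exact Relation.ReflTransGen.refl
  | tail _ hbc ih => exact ih.tail hbc.1

/-- **(F4)**: a red bare walk from the probe avoiding `D_a` that ends in the zone `Z = zone z` of a tail-free `O` ends in
`REACH_Z`: it enters `Z` through an anchor and continues inside `Z` through non-deleted vertices (no cube-state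
hypothesis is needed: the entering edge is red in `O` because blue bare `O`-edges stay inside zones). -/
theorem reachZone_of_bareWalkAvoiding [Fintype V] {O S : Config E} (hO : G.TailFree a b c O)
    (hc : c ∉ G.cluster Sᶜ a) {z v : V}
    (hv : v ∈ G.zone a b O z)
    (h : Relation.ReflTransGen (fun x y => G.BareAdj a b S x y ∧ y ∉ G.cluster Sᶜ a) c v) :
    G.ReachZone a b c O S (G.zone a b O z) v := by
  have key : ∀ x, Relation.ReflTransGen (fun x y => G.BareAdj a b S x y ∧ y ∉ G.cluster Sᶜ a) c x →
      x ∉ G.zone a b O z ∨ G.ReachZone a b c O S (G.zone a b O z) x := by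
    intro x hx
    induction hx with
    | refl =>
      by_cases hcz : c ∈ G.zone a b O z
      · exact Or.inr ⟨c, hcz, Relation.ReflTransGen.refl, hc, Relation.ReflTransGen.refl⟩
      · exact Or.inl hcz
    | @tail x y _ hxy ih =>
      obtain ⟨⟨e, he, hSe, hj⟩, hyD⟩ := hxy
      by_cases hyz : y ∈ G.zone a b O z
      · right
        rcases ih with hxz | ⟨w, hwz, hwK, hwD, hwx⟩
        · have hOe : O e = true := O_red_of_leaves_zone a b hxz hyz he hj
          have hyK : y ∈ G.BareReach a b c O := by
            rcases hj with ⟨_, h2⟩ | ⟨h1, _⟩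
            · exact h2 ▸ (hO e he hOe).2
            · exact h1 ▸ (hO e he hOe).1
          exact ⟨y, hyz, hyK, hyD, Relation.ReflTransGen.refl⟩
        · have hxz : x ∈ G.zone a b O z := mem_of_redIn_walk hwz (redIn_walk_of_avoiding a b hwx)
          exact ⟨w, hwz, hwK, hwD, hwx.tail ⟨⟨e, zoneEdge_of_joins he hj hxz hyz, he, hSe, hj⟩, hyD⟩⟩
      · exact Or.inl hyz
  rcases key v h with hvz | hreach
  · exact absurd hv hvz
  · exact hreach

/-- A red bare walk avoiding a set is a red bare walk. -/
theorem bareWalk_of_avoiding {S : Config E} {W : Set V} {u v : V}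
    (h : Relation.ReflTransGen (fun x y => G.BareAdj a b S x y ∧ y ∉ W) u v) :
    Relation.ReflTransGen (G.BareAdj a b S) u v := by
  induction h with
  | refl => exact Relation.ReflTransGen.refl
  | tail _ hbc ih => exact ih.tail hbc.1

/-- **Lemma A with an avoided set**: a red walk avoiding `W` from a non-terminal `u` to `v` either is a red bare walk
avoiding `W` or leaves the bare part through a red terminal edge to a terminal `t ∉ W` reached by such a walk, and
continues from `t` avoiding `W`. -/
theorem bareWalkAvoiding_or_redAttached_of_walkAvoiding {S : Config E} {W : Set V} {u v : V}
    (hu : u ≠ a ∧ u ≠ b) (h : G.WalkAvoiding S W u v) :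
    Relation.ReflTransGen (fun x y => G.BareAdj a b S x y ∧ y ∉ W) u v ∨
      ∃ t, (t = a ∨ t = b) ∧ t ∉ W ∧
        (∃ w, Relation.ReflTransGen (fun x y => G.BareAdj a b S x y ∧ y ∉ W) u w ∧
          ∃ e, S e = true ∧ G.Joins e w t) ∧
        Relation.ReflTransGen (fun x y => G.OpenAdj S x y ∧ y ∉ W) t v := by
  obtain ⟨_, hw⟩ := h
  induction hw with
  | refl => exact Or.inl Relation.ReflTransGen.refl
  | @tail x y _ hxy ih =>
    obtain ⟨hxy, hyW⟩ := hxy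
    rcases ih with hx | ⟨t, ht, htW, hatt, hconn⟩
    · by_cases hy : y = a ∨ y = b
      · obtain ⟨e, hSe, hj⟩ := hxy
        exact Or.inr ⟨y, hy, hyW, ⟨x, hx, e, hSe, hj⟩, Relation.ReflTransGen.refl⟩
      · have hx' : x ≠ a ∧ x ≠ b := ne_terminal_of_bareReach (bareWalk_of_avoiding a b hx) hu
        exact Or.inl (hx.tail ⟨bareAdj_of_openAdj hxy hx' ⟨fun h => hy (Or.inl h), fun h => hy (Or.inr h)⟩, hyW⟩)
    · exact Or.inr ⟨t, ht, htW, hatt, hconn.tail ⟨hxy, hyW⟩⟩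

/-- **`Good_a` decomposed at the first arrival at `b`**: a red walk from the probe to `b` avoiding `D_a` ends with a red
`b`-edge at a vertex `w ∉ D_a` reached from the probe by a red bare walk avoiding `D_a`. -/
theorem exists_bareWalkAvoiding_of_goodA {S : Config E} (hc : c ≠ a ∧ c ≠ b)
    (h : G.WalkAvoiding S (G.cluster Sᶜ a) c b) :
    ∃ w, Relation.ReflTransGen (fun x y => G.BareAdj a b S x y ∧ y ∉ G.cluster Sᶜ a) c w ∧
      w ∉ G.cluster Sᶜ a ∧ ∃ e, S e = true ∧ G.Joins e w b := by
  rcases bareWalkAvoiding_or_redAttached_of_walkAvoiding a b hc h with h' | ⟨t, ht, htD, ⟨w, hw, e, hSe, hj⟩, _⟩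
  · exact absurd rfl (ne_terminal_of_bareReach (bareWalk_of_avoiding a b h') hc).2
  · rcases ht with rfl | rfl
    · exact absurd (self_mem_cluster G Sᶜ t) htD
    · refine ⟨w, hw, ?_, e, hSe, hj⟩
      rcases Relation.ReflTransGen.cases_tail hw with rfl | ⟨_, _, hlast⟩
      · exact h.1
      · exact hlast.2

end Reach

end MultiGraph

end PercRepro
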